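import Literature.AlgebraicGeometry.Motives.MumfordTateRankInvariance
import Literature.AlgebraicGeometry.Motives.HodgeTensorPowerProofs
import Literature.AlgebraicGeometry.Motives.HodgeTensorDualProofs
import HarnessLib

/-!
# Route PeriodDeficiency — `QbarGenericIsHodgeGeneric` (stmt-HodgeConjecture-11595), line `registered`: the `ℂ`-linear derivation action on tensor spaces and its transport (helper for stub S2 `stub_mtRank_eq_of_tensorComparison`)

Helper file for the registered stub `stub_mtRank_eq_of_tensorComparison` (S2 of reshape r6 of
the line skeleton `Cruxes/QbarGenericIsHodgeGeneric/Lines/birth.lean`): the pure linear algebra of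
the **`ℂ`-linear derivation (Leibniz) action** of `End_ℂ(M)` on the `ℂ`-tensor spaces
`M^{⊗a} ⊗ (M^∨)^{⊗b}` (Deligne, *Hodge cycles on abelian varieties*, LNM 900, I §3.1: the
differential at `1` of `g ↦ g^{⊗a} ⊗ ((g⁻¹)ᵀ)^{⊗b}`), i.e. the tree's `tensorPowerDeriv` /
`tensorSpaceDeriv` (`Literature/AlgebraicGeometry/Motives/AtypicalHodgeLocus.lean`, hard-wired to
the field `ℚ`) with `ℚ ↦ ℂ`. No definition is introduced: the two actions are the EXPLICIT TERMS

* `D^r_M := ∑ i : Fin r, (PiTensorProduct.mapMultilinear ℂ (fun _ => M) (fun _ => M)).toLinearMap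
  (fun _ => LinearMap.id) i : End_ℂ M →ₗ[ℂ] End_ℂ (M^{⊗r})` (Leibniz action on `M^{⊗r}`),
* `D^{a,b}_M := rTensorHom _ ∘ D^a_M + lTensorHom _ ∘ D^b_{M^∨} ∘ (-transpose) :
  End_ℂ M →ₗ[ℂ] End_ℂ (M^{⊗a} ⊗ (M^∨)^{⊗b})` (Leibniz on `M^{⊗a}`, contragredient Leibniz on
  `(M^∨)^{⊗b}`),

written out in every statement (below, "`X · t`" abbreviates `D^{a,b}_M X t`). The file proves:

* the Leibniz formula on pure tensors (`derivPowC_tprod`) and its naturality in commuting squares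
  of linear maps (`map_derivPowC_of_comp_eq`, the tree's `map_tensorPowerDeriv` over `ℂ`);
* **transport of annihilation conditions** (`forall_derivSpaceC_eq_zero_iff_of_map_eq`): for a
  `ℂ`-linear equivalence `e : M ≃ M'` with tensor functoriality
  `T e = e^{⊗a} ⊗ ((e⁻¹)ᵀ)^{⊗b}` (`TensorProduct.congr` of `PiTensorProduct.congr`s, as in the
  tree's `tensorSpaceAct`) and subspaces `S`, `S'` with `T e (S) = S'`: `X` kills `S` iff
  `e X e⁻¹` kills `S'` — through the equivariance `T e (X · t) = (e X e⁻¹) · (T e t)` (the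
  `ℂ`-version, between two spaces, of the tree's `tensorSpaceCongr_tensorSpaceDeriv`);
  `forall_mem_span_image_eq_zero_iff` (a linear map kills a span iff it kills the generators);
* **naturality of the comparison map**
  `𝒞 = (piTensorBaseChange V ⊗ ((dualBaseChange V)^{⊗b} ∘ piTensorBaseChange V^∨)) ∘
  tensorBaseChange : ℂ ⊗ T^{a,b} V → (ℂ ⊗ V)^{⊗a} ⊗ ((ℂ ⊗ V)^∨)^{⊗b}` (the tree's comparison
  maps of `Motives/HodgeTensor.lean`; this composite is the one appearing in the registered stubs
  S1–S3) with respect to rational endomorphisms `X ∈ End_ℚ V`: `X_ℂ · 𝒞(z) = 𝒞((X · -)_ℂ z)`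
  (`derivPowC_piTensorBaseChange`, `derivPowC_dualComparison`), in the form needed downstream,
  for complexified endomorphisms `ζ ∈ ℂ ⊗ End_ℚ V`:
  `(homBaseChange ζ) · 𝒞(1 ⊗ t) = 𝒞((X ↦ X · t)_ℂ ζ)`
  (`derivSpaceC_homBaseChange_tensorComparison`); and the **injectivity of `𝒞`**
  (`tensorComparison_injective`, from `piTensorBaseChange_bijective`, `dualBaseChange_injective`
  and flatness over the field `ℂ`; no finite-dimensionality needed).

All proofs are the routine verifications on pure tensors (the tree's `map_tensorPowerDeriv`,
`conj_symm_dualMap_dualMap`, `piTensorBaseChange_map_baseChange`,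
`dualBaseChange_symm_dualMap_baseChange`, with `ℚ ↦ ℂ` resp. with a linear map in place of a
linear equivalence). Everything is a theorem; no definition, notation or named fact is introduced.

## References

* [Deligne1982HodgeCycles] P. Deligne, Hodge cycles on abelian varieties, in LNM 900 (1982), I §3
  (3.1: the tensor spaces `T^{a,b}` with their `GL(V)`-action; Prop. 3.1, 3.4).
* [DeligneHodgeII1971] P. Deligne, Théorie de Hodge II, Publ. Math. IHÉS 40 (1971), 1.1.6–1.1.12
  (duals and tensor products, compatibly with extension of scalars).
-/

noncomputable section

-- every declaration of this problem lives in `Summit.HodgeConjecture.HodgeConjecture.…` (summit = sub-problem)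
set_option linter.dupNamespace false

open scoped TensorProduct PiTensorProduct
open Literature.AlgebraicGeometry.Motives

namespace Summit.HodgeConjecture.HodgeConjecture.Theorems

/-! ### The `ℂ`-linear Leibniz action on tensor powers -/

section Complex

variable {M M' : Type*} [AddCommGroup M] [Module ℂ M] [AddCommGroup M'] [Module ℂ M']

/-- The `ℂ`-linear Leibniz action `D^r_M` on pure tensors:
`X · (⊗ᵢ vᵢ) = Σᵢ ⊗ⱼ (update v i (X vᵢ))ⱼ` (Deligne, LNM 900, I 3.1; the tree's
`tensorPowerDeriv_tprod` over `ℂ`). [folklore] -/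
theorem derivPowC_tprod (r : ℕ) (X : Module.End ℂ M) (v : Fin r → M) :
    (∑ i : Fin r, (PiTensorProduct.mapMultilinear ℂ (fun _ : Fin r => M)
      (fun _ : Fin r => M)).toLinearMap (fun _ => LinearMap.id) i) X (PiTensorProduct.tprod ℂ v) =
      ∑ i, PiTensorProduct.tprod ℂ (Function.update v i (X (v i))) := by
  simp only [LinearMap.sum_apply, MultilinearMap.toLinearMap_apply,
    PiTensorProduct.mapMultilinear_apply, PiTensorProduct.map_tprod]
  refine Finset.sum_congr rfl fun i _ => ?_
  congr 1
  funext j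
  exact Function.apply_update (fun k (F : Module.End ℂ M) => F (v k)) (fun _ => LinearMap.id) i X j

/-- **Naturality of the Leibniz action in commuting squares**: if `X' ∘ f = f ∘ X` for a
`ℂ`-linear `f : M → M'`, then `f^{⊗r} (X · x) = X' · (f^{⊗r} x)` (the tree's
`map_tensorPowerDeriv`, over `ℂ` and for a linear map rather than an equivalence). [folklore] -/
theorem map_derivPowC_of_comp_eq (r : ℕ) (f : M →ₗ[ℂ] M') (X : Module.End ℂ M)
    (X' : Module.End ℂ M') (h : X' ∘ₗ f = f ∘ₗ X) (x : ⨂[ℂ]^r M) :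
    PiTensorProduct.map (fun _ : Fin r => f)
        ((∑ i : Fin r, (PiTensorProduct.mapMultilinear ℂ (fun _ : Fin r => M)
          (fun _ : Fin r => M)).toLinearMap (fun _ => LinearMap.id) i) X x) =
      (∑ i : Fin r, (PiTensorProduct.mapMultilinear ℂ (fun _ : Fin r => M')
        (fun _ : Fin r => M')).toLinearMap (fun _ => LinearMap.id) i) X'
          (PiTensorProduct.map (fun _ : Fin r => f) x) := by
  induction x using PiTensorProduct.induction_on with
  | smul_tprod c v =>
    simp only [map_smul, PiTensorProduct.map_tprod, derivPowC_tprod, map_sum]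
    congr 1
    refine Finset.sum_congr rfl fun i _ => ?_
    congr 1
    funext j
    by_cases hj : j = i
    · subst hj
      simpa [Function.update_self] using (LinearMap.congr_fun h (v j)).symm
    · simp [Function.update_of_ne hj]
  | add x y hx hy => simp only [map_add, hx, hy]

/-- `PiTensorProduct.congr` is `PiTensorProduct.map` of the underlying linear maps. [folklore] -/
theorem piTensorCongr_apply {r : ℕ} (e : M ≃ₗ[ℂ] M') (x : ⨂[ℂ]^r M) :
    PiTensorProduct.congr (fun _ : Fin r => e) x =
      PiTensorProduct.map (fun _ : Fin r => (e : M →ₗ[ℂ] M')) x := rfl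

/-- **Transport of annihilation conditions along a `ℂ`-linear equivalence** `e : M ≃ M'`: if the
tensor functoriality `T e = e^{⊗a} ⊗ ((e⁻¹)ᵀ)^{⊗b}` maps the subspace `S ⊆ M^{⊗a} ⊗ (M^∨)^{⊗b}`
onto `S'`, then `X ∈ End_ℂ M` kills `S` under the derivation action `D^{a,b}_M` iff `e X e⁻¹`
kills `S'` under `D^{a,b}_{M'}`. The point is the equivariance `T e (X · t) = (e X e⁻¹) · (T e t)`
(Deligne, LNM 900, I 3.1: `T^{a,b}` is a representation of `GL`, differentiated; the tree's
`tensorSpaceCongr_tensorSpaceDeriv` over `ℂ` and between two spaces), checked on `x ⊗ ξ` with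
`map_derivPowC_of_comp_eq` for `e` (`(e X e⁻¹) ∘ e = e ∘ X`) and for `(e⁻¹)ᵀ`
(`(e X e⁻¹)ᵀ ∘ (e⁻¹)ᵀ = (e⁻¹)ᵀ ∘ Xᵀ`). [cite: Deligne1982HodgeCycles, I Prop. 3.1 and 3.4] -/
theorem forall_derivSpaceC_eq_zero_iff_of_map_eq (e : M ≃ₗ[ℂ] M') (a b : ℕ)
    (S : Submodule ℂ ((⨂[ℂ]^a M) ⊗[ℂ] (⨂[ℂ]^b (Module.Dual ℂ M))))
    (S' : Submodule ℂ ((⨂[ℂ]^a M') ⊗[ℂ] (⨂[ℂ]^b (Module.Dual ℂ M'))))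
    (hS : S.map (TensorProduct.congr (PiTensorProduct.congr fun _ : Fin a => e)
      (PiTensorProduct.congr fun _ : Fin b => e.symm.dualMap)).toLinearMap = S')
    (X : Module.End ℂ M) :
    (∀ s ∈ S,
      ((LinearMap.rTensorHom _ ∘ₗ
          ∑ i : Fin a, (PiTensorProduct.mapMultilinear ℂ (fun _ : Fin a => M)
            (fun _ : Fin a => M)).toLinearMap (fun _ => LinearMap.id) i) +
        LinearMap.lTensorHom _ ∘ₗ
          (∑ i : Fin b, (PiTensorProduct.mapMultilinear ℂ (fun _ : Fin b => Module.Dual ℂ M)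
            (fun _ : Fin b => Module.Dual ℂ M)).toLinearMap (fun _ => LinearMap.id) i) ∘ₗ
            (-Module.Dual.transpose) :
        Module.End ℂ M →ₗ[ℂ] Module.End ℂ ((⨂[ℂ]^a M) ⊗[ℂ] (⨂[ℂ]^b (Module.Dual ℂ M))))
        X s = 0) ↔
    ∀ s' ∈ S',
      ((LinearMap.rTensorHom _ ∘ₗ
          ∑ i : Fin a, (PiTensorProduct.mapMultilinear ℂ (fun _ : Fin a => M')
            (fun _ : Fin a => M')).toLinearMap (fun _ => LinearMap.id) i) +
        LinearMap.lTensorHom _ ∘ₗ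
          (∑ i : Fin b, (PiTensorProduct.mapMultilinear ℂ (fun _ : Fin b => Module.Dual ℂ M')
            (fun _ : Fin b => Module.Dual ℂ M')).toLinearMap (fun _ => LinearMap.id) i) ∘ₗ
            (-Module.Dual.transpose) :
        Module.End ℂ M' →ₗ[ℂ] Module.End ℂ ((⨂[ℂ]^a M') ⊗[ℂ] (⨂[ℂ]^b (Module.Dual ℂ M'))))
        (e.conj X) s' = 0 := by
  have h₁ : e.conj X ∘ₗ (e : M →ₗ[ℂ] M') = (e : M →ₗ[ℂ] M') ∘ₗ X := by
    ext v
    simp [LinearEquiv.conj_apply]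
  have h₂ : (e.conj X).dualMap ∘ₗ (e.symm.dualMap : Module.Dual ℂ M →ₗ[ℂ] Module.Dual ℂ M') =
      (e.symm.dualMap : Module.Dual ℂ M →ₗ[ℂ] Module.Dual ℂ M') ∘ₗ X.dualMap := by
    ext φ w
    simp [LinearEquiv.conj_apply, LinearEquiv.dualMap_apply, LinearMap.dualMap_apply]
  subst hS
  simp only [Submodule.mem_map, LinearEquiv.coe_coe, forall_exists_index, and_imp,
    forall_apply_eq_imp_iff₂]
  refine forall₂_congr fun s hs => ?_
  clear hs
  -- equivariance `T e (X · s) = (e X e⁻¹) · (T e s)`, then injectivity of `T e`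
  refine (LinearEquiv.map_eq_zero_iff (TensorProduct.congr (PiTensorProduct.congr fun _ : Fin a => e)
    (PiTensorProduct.congr fun _ : Fin b => e.symm.dualMap))).symm.trans (Eq.congr_left ?_)
  induction s using TensorProduct.induction_on with
  | zero => simp only [map_zero]
  | add x y hx hy => simp only [map_add, hx, hy]
  | tmul x ξ =>
    simp only [LinearMap.add_apply, LinearMap.comp_apply, LinearMap.neg_apply,
      LinearMap.coe_rTensorHom, LinearMap.coe_lTensorHom, LinearMap.rTensor_tmul,
      LinearMap.lTensor_tmul, map_neg, ← LinearMap.dualMap_def, map_add,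
      TensorProduct.congr_tmul, piTensorCongr_apply]
    rw [map_derivPowC_of_comp_eq a (e : M →ₗ[ℂ] M') X (e.conj X) h₁,
      map_derivPowC_of_comp_eq b (e.symm.dualMap : Module.Dual ℂ M →ₗ[ℂ] Module.Dual ℂ M')
        X.dualMap (e.conj X).dualMap h₂]

/-- A linear map kills the span of an image iff it kills the images of the generators.
[folklore] -/
theorem forall_mem_span_image_eq_zero_iff {R N P α σ : Type*} [Semiring R] [AddCommMonoid N]
    [Module R N] [AddCommMonoid P] [Module R P] [SetLike σ α] (L : N →ₗ[R] P) (f : α → N)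
    (C : σ) : (∀ s ∈ Submodule.span R (f '' (C : Set α)), L s = 0) ↔ ∀ t ∈ C, L (f t) = 0 := by
  constructor
  · exact fun h t ht => h _ (Submodule.subset_span ⟨t, ht, rfl⟩)
  · intro h s hs
    induction hs using Submodule.span_induction with
    | mem x hx =>
      obtain ⟨t, ht, rfl⟩ := hx
      exact h t ht
    | zero => exact map_zero L
    | add x y _ _ hx hy => rw [map_add, hx, hy, add_zero]
    | smul c x _ hx => rw [map_smul, hx, smul_zero]

end Complex

/-! ### Naturality of the comparison map `𝒞` with respect to rational endomorphisms -/

section Rational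

universe u

variable {V : Type u} [AddCommGroup V] [Module ℚ V]

/-- `X_ℂ (1 ⊗ v) = 1 ⊗ X v`. [folklore] -/
theorem baseChange_ofRat (X : Module.End ℚ V) (v : V) :
    X.baseChange ℂ (HodgeStructure.ofRat v) = HodgeStructure.ofRat (X v) := rfl

/-- **Naturality of `piTensorBaseChange` for the Leibniz actions**: for `X ∈ End_ℚ V`,
`X_ℂ · (piTensorBaseChange z) = piTensorBaseChange ((X · -)_ℂ z)` on `ℂ ⊗ V^{⊗r}` (checked on
`c ⊗ (⊗ᵢ vᵢ)`, as the tree's `piTensorBaseChange_map_baseChange`). [folklore] -/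
theorem derivPowC_piTensorBaseChange (r : ℕ) (X : Module.End ℚ V) (z : ℂ ⊗[ℚ] (⨂[ℚ]^r V)) :
    (∑ i : Fin r, (PiTensorProduct.mapMultilinear ℂ (fun _ : Fin r => ℂ ⊗[ℚ] V)
      (fun _ : Fin r => ℂ ⊗[ℚ] V)).toLinearMap (fun _ => LinearMap.id) i) (X.baseChange ℂ)
        (HodgeStructure.piTensorBaseChange V (Fin r) z) =
      HodgeStructure.piTensorBaseChange V (Fin r) ((tensorPowerDeriv V r X).baseChange ℂ z) := by
  induction z using TensorProduct.induction_on with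
  | zero => simp only [map_zero]
  | add x y hx hy => simp only [map_add, hx, hy]
  | tmul c z =>
    induction z using PiTensorProduct.induction_on with
    | smul_tprod q v =>
      have hupd : ∀ i : Fin r, Function.update (fun j => HodgeStructure.ofRat (v j)) i
          (X.baseChange ℂ (HodgeStructure.ofRat (v i))) =
            fun j => (HodgeStructure.ofRat (Function.update v i (X (v i)) j) : ℂ ⊗[ℚ] V) :=
        fun i => funext fun j => by
          rw [baseChange_ofRat]
          exact (Function.apply_update (fun _ w => HodgeStructure.ofRat w) v i (X (v i)) j).symm
      rw [← TensorProduct.smul_tmul]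
      simp only [LinearMap.baseChange_tmul, tensorPowerDeriv_tprod, TensorProduct.tmul_sum, map_sum,
        HodgeStructure.piTensorBaseChange_tmul_tprod, map_smul, derivPowC_tprod, Finset.smul_sum,
        hupd]
    | add x y hx hy => simp only [TensorProduct.tmul_add, map_add, hx, hy]

/-- `dualBaseChange` is natural in rational endomorphisms: `⟨(Xᵀ)_ℂ ζ, y⟩ = ⟨ζ, X_ℂ y⟩`
(as the tree's `dualBaseChange_symm_dualMap_baseChange`). [folklore] -/
theorem dualBaseChange_dualMap_baseChange_apply (X : Module.End ℚ V)
    (ζ : ℂ ⊗[ℚ] Module.Dual ℚ V) (y : ℂ ⊗[ℚ] V) :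
    HodgeStructure.dualBaseChange V ((X.dualMap).baseChange ℂ ζ) y =
      HodgeStructure.dualBaseChange V ζ (X.baseChange ℂ y) := by
  induction ζ using TensorProduct.induction_on with
  | zero => simp
  | add ζ₁ ζ₂ h₁ h₂ => simp only [map_add, LinearMap.add_apply, h₁, h₂]
  | tmul c φ =>
    induction y using TensorProduct.induction_on with
    | zero => simp
    | add y₁ y₂ h₁ h₂ => simp only [map_add, h₁, h₂]
    | tmul d w =>
      simp [LinearMap.baseChange_tmul, HodgeStructure.dualBaseChange_tmul_tmul,
        LinearMap.dualMap_apply]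

/-- **Naturality of the dual comparison for the Leibniz actions**: on `ℂ ⊗ (V^∨)^{⊗b}`,
`(X_ℂ)ᵀ · ((dualBaseChange V)^{⊗b} (piTensorBaseChange z)) =
(dualBaseChange V)^{⊗b} (piTensorBaseChange ((Xᵀ · -)_ℂ z))` (`map_derivPowC_of_comp_eq` for the
square `(X_ℂ)ᵀ ∘ dualBaseChange = dualBaseChange ∘ (Xᵀ)_ℂ`, then
`derivPowC_piTensorBaseChange` for `V^∨`). [folklore] -/
theorem derivPowC_dualComparison (b : ℕ) (X : Module.End ℚ V)
    (z : ℂ ⊗[ℚ] (⨂[ℚ]^b (Module.Dual ℚ V))) :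
    (∑ i : Fin b, (PiTensorProduct.mapMultilinear ℂ (fun _ : Fin b => Module.Dual ℂ (ℂ ⊗[ℚ] V))
      (fun _ : Fin b => Module.Dual ℂ (ℂ ⊗[ℚ] V))).toLinearMap (fun _ => LinearMap.id) i)
        (X.baseChange ℂ).dualMap
        (PiTensorProduct.map (fun _ : Fin b => HodgeStructure.dualBaseChange V)
          (HodgeStructure.piTensorBaseChange (Module.Dual ℚ V) (Fin b) z)) =
      PiTensorProduct.map (fun _ : Fin b => HodgeStructure.dualBaseChange V)
        (HodgeStructure.piTensorBaseChange (Module.Dual ℚ V) (Fin b)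
          ((tensorPowerDeriv (Module.Dual ℚ V) b X.dualMap).baseChange ℂ z)) := by
  have hcomm : (X.baseChange ℂ).dualMap ∘ₗ HodgeStructure.dualBaseChange V =
      HodgeStructure.dualBaseChange V ∘ₗ (X.dualMap).baseChange ℂ := by
    refine LinearMap.ext fun ζ => LinearMap.ext fun y => ?_
    simp only [LinearMap.coe_comp, Function.comp_apply, LinearMap.dualMap_apply]
    exact (dualBaseChange_dualMap_baseChange_apply X ζ y).symm
  rw [← map_derivPowC_of_comp_eq b (HodgeStructure.dualBaseChange V) ((X.dualMap).baseChange ℂ)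
    ((X.baseChange ℂ).dualMap) hcomm, derivPowC_piTensorBaseChange b X.dualMap z]

/-- **The comparison `𝒞 : ℂ ⊗ T^{a,b} V → (ℂ ⊗ V)^{⊗a} ⊗ ((ℂ ⊗ V)^∨)^{⊗b}` is injective**: it is
`tensorBaseChange` (an isomorphism) followed by the tensor product, over the field `ℂ` (all
modules flat), of the bijection `piTensorBaseChange V` (`piTensorBaseChange_bijective`) and of
`(dualBaseChange V)^{⊗b} ∘ piTensorBaseChange V^∨`, injective since `dualBaseChange V` is
(`dualBaseChange_injective`; an injective linear map of `ℂ`-vector spaces has a retraction, so its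
tensor power is injective). No finite-dimensionality is needed. [folklore] -/
theorem tensorComparison_injective (a b : ℕ) :
    Function.Injective ((TensorProduct.map (HodgeStructure.piTensorBaseChange V (Fin a))
        ((PiTensorProduct.map fun _ => HodgeStructure.dualBaseChange V) ∘ₗ
          HodgeStructure.piTensorBaseChange _ (Fin b))) ∘ₗ
      (HodgeStructure.tensorBaseChange _ _).toLinearMap) := by
  have h₁ := (HodgeStructure.piTensorBaseChange_bijective V (Fin a)).1
  have h₂ : Function.Injective
      (PiTensorProduct.map fun _ : Fin b => HodgeStructure.dualBaseChange V) := by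
    obtain ⟨g, hg⟩ := LinearMap.exists_leftInverse_of_injective (HodgeStructure.dualBaseChange V)
      HodgeStructure.ker_dualBaseChange
    refine Function.LeftInverse.injective (g := PiTensorProduct.map fun _ : Fin b => g) fun x => ?_
    rw [← LinearMap.comp_apply, ← PiTensorProduct.map_comp]
    simp [hg]
  have h₃ : Function.Injective
      ((PiTensorProduct.map fun _ : Fin b => HodgeStructure.dualBaseChange V) ∘ₗ
        HodgeStructure.piTensorBaseChange (Module.Dual ℚ V) (Fin b)) := by
    rw [LinearMap.coe_comp]
    exact h₂.comp (HodgeStructure.piTensorBaseChange_bijective _ (Fin b)).1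
  rw [LinearMap.coe_comp, LinearEquiv.coe_coe]
  exact (TensorProduct.map_injective_of_flat_flat _ _ h₁ h₃).comp
    (HodgeStructure.tensorBaseChange _ _).injective

/-- **The derivation action of a complexified endomorphism on a comparison image**: for
`ζ ∈ ℂ ⊗ End_ℚ V` and `t ∈ T^{a,b} V`,
`(homBaseChange ζ) · 𝒞(1 ⊗ t) = 𝒞((X ↦ X · t)_ℂ ζ)`, where on the left `·` is the `ℂ`-linear
derivation action `D^{a,b}_{ℂ ⊗ V}` and on the right `X · t = tensorSpaceDeriv V a b X t` is the
rational one: base change of the rational derivation action is the `ℂ`-linear derivation action,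
through the comparison isomorphisms of Deligne, Hodge II, 1.1.6–1.1.12. Reduced by linearity to
`ζ = c ⊗ X` (`homBaseChange (c ⊗ X) = c • X_ℂ`) and `t = x ⊗ ξ`, where it is
`derivPowC_piTensorBaseChange` and `derivPowC_dualComparison`. [folklore] -/
theorem derivSpaceC_homBaseChange_tensorComparison (a b : ℕ) (ζ : ℂ ⊗[ℚ] Module.End ℚ V)
    (t : hodgeTensorSpace V a b) :
    ((LinearMap.rTensorHom _ ∘ₗ
        ∑ i : Fin a, (PiTensorProduct.mapMultilinear ℂ (fun _ : Fin a => ℂ ⊗[ℚ] V)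
          (fun _ : Fin a => ℂ ⊗[ℚ] V)).toLinearMap (fun _ => LinearMap.id) i) +
      LinearMap.lTensorHom _ ∘ₗ
        (∑ i : Fin b, (PiTensorProduct.mapMultilinear ℂ
          (fun _ : Fin b => Module.Dual ℂ (ℂ ⊗[ℚ] V))
          (fun _ : Fin b => Module.Dual ℂ (ℂ ⊗[ℚ] V))).toLinearMap (fun _ => LinearMap.id) i) ∘ₗ
          (-Module.Dual.transpose) :
      Module.End ℂ (ℂ ⊗[ℚ] V) →ₗ[ℂ]
        Module.End ℂ ((⨂[ℂ]^a (ℂ ⊗[ℚ] V)) ⊗[ℂ] (⨂[ℂ]^b (Module.Dual ℂ (ℂ ⊗[ℚ] V)))))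
      (HodgeStructure.homBaseChange V V ζ)
      (((TensorProduct.map (HodgeStructure.piTensorBaseChange V (Fin a))
          ((PiTensorProduct.map fun _ => HodgeStructure.dualBaseChange V) ∘ₗ
            HodgeStructure.piTensorBaseChange _ (Fin b))) ∘ₗ
        (HodgeStructure.tensorBaseChange _ _).toLinearMap) ((1 : ℂ) ⊗ₜ[ℚ] t)) =
    ((TensorProduct.map (HodgeStructure.piTensorBaseChange V (Fin a))
        ((PiTensorProduct.map fun _ => HodgeStructure.dualBaseChange V) ∘ₗ
          HodgeStructure.piTensorBaseChange _ (Fin b))) ∘ₗ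
      (HodgeStructure.tensorBaseChange _ _).toLinearMap)
      (((tensorSpaceDeriv V a b).flip t).baseChange ℂ ζ) := by
  induction ζ using TensorProduct.induction_on with
  | zero => simp only [map_zero, LinearMap.zero_apply]
  | add x y hx hy => rw [map_add, map_add, LinearMap.add_apply, hx, hy, map_add, map_add]
  | tmul c X =>
    rw [HodgeStructure.homBaseChange_tmul, map_smul, LinearMap.smul_apply, LinearMap.baseChange_tmul,
      LinearMap.flip_apply, show c ⊗ₜ[ℚ] tensorSpaceDeriv V a b X t =
        c • ((1 : ℂ) ⊗ₜ[ℚ] tensorSpaceDeriv V a b X t) by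
          rw [TensorProduct.smul_tmul', smul_eq_mul, mul_one], map_smul]
    congr 1
    -- now `ζ = 1 ⊗ X`: check `X_ℂ · 𝒞(1 ⊗ t) = 𝒞(1 ⊗ X · t)` on pure tensors `t = x ⊗ ξ`
    induction t using TensorProduct.induction_on with
    | zero => simp only [TensorProduct.tmul_zero, map_zero]
    | add t₁ t₂ h₁ h₂ => simp only [TensorProduct.tmul_add, map_add, h₁, h₂]
    | tmul x ξ =>
      simp only [tensorSpaceDeriv_tmul, sub_eq_add_neg, TensorProduct.tmul_add,
        TensorProduct.tmul_neg, map_add, map_neg, LinearMap.coe_comp, Function.comp_apply,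
        LinearEquiv.coe_coe, HodgeStructure.tensorBaseChange_tmul, TensorProduct.map_tmul,
        LinearMap.add_apply, LinearMap.neg_apply, LinearMap.coe_rTensorHom,
        LinearMap.coe_lTensorHom, LinearMap.rTensor_tmul, LinearMap.lTensor_tmul,
        ← LinearMap.dualMap_def, derivPowC_piTensorBaseChange, derivPowC_dualComparison,
        LinearMap.baseChange_tmul]

end Rational

end Summit.HodgeConjecture.HodgeConjecture.Theorems

end
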